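import Mathlib

/-!
# `Balaban1983to89.T4JetTower` — the SECOND-ORDER CHAIN RULE ALONG A CONTRACTION TOWER (toy witness, one real
# variable): the second derivative of an `n`-fold iterate decays at the FIRST-order rate, not at its square, as soon
# as the one-step map has curvature (cell T4, node O3.E / NE1′, lane «observable-level telescoping», lineage
# `b2b-balaban-t4-ne1p-p3` gen 6, journal row T4-O3.E-NE1′-PROVE-P3f*; ADDITIVE LEAF — imports Mathlib only, no tree
# module is touched, no importer)

HONEST FRAMING.  Audit cell `pub-balaban`; the cell's T⁴ target is rung (B)+1 = the `ε → 0` limit of expectations of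
unit-scale averaged gauge-invariant loop variables on ONE four-torus of fixed physical size, under (B) =
[Balaban1989LargeFieldII] Thm 1 and a β-function hypothesis carried as explicit antecedents elsewhere in the tree;
NOT infinite volume, NOT a mass gap, NOT the Clay problem, and nothing here is progress on any of them.  THIS FILE
CONTAINS NO STATEMENT ABOUT BAŁABAN'S RENORMALIZATION-GROUP OBJECTS AT ALL: it is elementary one-variable calculus
([folklore], sorry-free) recording, in kernel-checked form, the arithmetic of second derivatives of iterates that the
lane's records use (record `t4/T4-EST-NE1p-P3.md` v6 §11c).  Value = a toy witness for a located NEGATIVE finding of the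
cell's bookkeeping; NOT summit progress.

WHAT IS PROVED (all [folklore]).  For maps `T : ℝ → ℝ` with a fixed point `T 0 = 0`, derivative function `T₁`
(`HasDerivAt T (T₁ x) x` for all `x`) and a second derivative `T₂` of `T` at `0` (`HasDerivAt T₁ T₂ 0`), write
`θ := T₁ 0` (the one-step first-order rate) and let `D n`, `S n` be the chain-rule recursions
`D 0 = 1`, `D (n+1) x = T₁ (T^[n] x) · D n x` and `S 0 = 0`, `S (n+1) = T₂ · (D n 0)² + θ · S n`.
§1 `hasDerivAt_comp_pt`, `hasDerivAt_deriv_comp_zero`: the first- and second-order chain rule at a zero of the inner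
   map: `(f ∘ g)′ = f′(g)·g′` and, at `0` with `g 0 = 0`, `(x ↦ f₁ (g x) · g₁ x)′(0) = f₂ · g₁(0)² + f₁(0) · g₂` — the
   one-variable shadow of `D²(f∘g) = D²f[Dg, Dg] + Df ∘ D²g`.
§2 `TowerMap` (the data above), `hasDerivAt_iterate` (`D n` IS the derivative of `T^[n]`), `D_zero` (`D n 0 = θⁿ`),
   `hasDerivAt_D_zero` (`S n` IS the derivative of `D n` at `0`, i.e. the second derivative of `T^[n]` at the fixed
   point), the CLOSED FORM `S_succ_eq : S (n+1) = T₂ · Σ_{j ≤ n} θ^{n+j}` (`S_eq` with `n − 1`), the linear case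
   `S_eq_zero_of_T₂` (`T₂ = 0 ⇒ S n = 0`), and the bounds `T₂ θⁿ ≤ S (n+1) ≤ T₂ θⁿ / (1 − θ)` for `0 ≤ θ < 1 ≤ …`,
   `0 ≤ T₂` (`S_succ_lower`, `S_succ_upper`).
§3 THE RATE STATEMENT `exists_sq_rate_lt_S`: for `0 < θ < 1` and `0 < T₂`, `S n` is NOT `O(θ^{2n})` — for every `C`
   some `n` has `C · (θⁿ)² < S n`; and for an observable `W` (derivative function `W₁`, second derivative `W₂` at `0`)
   the second derivative of the pulled-back observable `W ∘ T^[n]` at the fixed point is `W₂ · (θⁿ)² + W₁ 0 · S n`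
   (`hasDerivAt_obs_iterate`), hence NOT `O(θ^{2n})` whenever `W₁ 0 ≠ 0` (`exists_sq_rate_lt_obs`); in the linear case
   it IS `W₂ · θ^{2n}` (`obs_second_eq_of_T₂`).
§4 NON-VACUITY: the quadratic map `x ↦ θ x + τ x²` is a `TowerMap` with `T₁ x = θ + 2τ x`, `T₂ = 2τ` (`quadratic`),
   so `S (n+1) = 2τ Σ_{j ≤ n} θ^{n+j}` there (`quadratic_S_succ`).

WHY THIS FILE (the located item, programme-internal context, NOT cited as a source of any statement).  The lane's
conditional-mean channel and the tree's second-order hypothesis SHAPES for loop variables of iterated averages —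
`T4AvgDerivBound.LoopPairDerivBound av dom C₂ θ₂` (unit `b2b-balaban-b07`) and `T4AvgDiagBound.LoopDiagDerivBound av dom
C₃ θ₃` (unit `b2b-balaban-t4-lean` gen 17) — carry in their records ∕ headers the EXPECTATION that a second-order tower
chain rule from one-step data would give the rates `θ₂, θ₃ ≍ θ₁²` (`θ₁` = the one-step first-order rate of
`T4AvgDerivBound.AvgStepContraction`), the value of the abelian model with a LINEAR averaging.  The composition law
proved here says otherwise for any one-step map with curvature: the curvature injected at the first step is transported
by the later steps at the FIRST-order rate, `S n ≥ T₂ θ^{n−1}`, so the honest output of such a chain rule is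
`θ₂ = θ₃ = θ₁` with an `n`-independent coefficient, and `θ₁²` only when the one-step second derivative vanishes.
Whether Bałaban's one-step averaging has non-zero gauge-covariant one-bond curvature is an [analysis] of the lane's
record (§11c: the Baker–Campbell–Hausdorff double commutator in the exponent of the printed formula quoted next), NOT a
statement of this file and NOT printed.

CITATION HEADER (lean-in-tree rule 2026-08-18).  The one printed formula this toy is a shadow of, verbatim, read by
this seat on the render `b2b-balaban-ref1/pages/1985-cmp98-averaging/1985-cmp98-averaging-p003-x2.png`:
T. Bałaban, *Averaging operations for lattice gauge theories*, Commun. Math. Phys. **98** (1985) 17–51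
[Balaban1985Averaging] (cell paper B7), p. 19 [PDF 3], (15): "Ū_c = exp[ i Σ_{x∈B(c₋)} L^{−d} (1/i) log U(Γ_{c,x}) U(c)^{−1} ] U(c)."
— a NON-LINEAR map of the fine configuration (logarithm, average, exponential), iterated once per renormalization step.
Context only, quoted by name from the tree and NOT re-read here: the same paper's Prop. 4 (134)–(135) p. 38 and Prop. 5
(157) p. 42 bound the second-order remainder `C_k` of the COMPOSED `k`-step averaging and its one-bond derivative in sup
norm with constants that do NOT decay in `k` (transcribed in `T4AvgDiagBound`'s citation header) — consistent with, and
not used by, anything below.  NOT used: any other statement of the paper; the manuscript series under audit is not cited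
for any disputed step; no programme-internal claim is cited as a source.  Hygiene: imports `Mathlib` only; no `Summits/`
name; no tree module imported or modified; 0 sorry.
-/

namespace Literature.MathematicalPhysics.QuantumFieldTheory.Balaban1983to89.T4JetTower

open Finset

/-! ## §1 The chain rule to second order at a zero of the inner map -/

section ChainRule

variable {f g f₁ g₁ : ℝ → ℝ} {f₂ g₂ : ℝ}

/-- First-order chain rule, pointwise form: if `f′ = f₁` and `g′ = g₁` everywhere then `(f ∘ g)′(x) = f₁ (g x) · g₁ x`.
[folklore] -/
theorem hasDerivAt_comp_pt (hf : ∀ x, HasDerivAt f (f₁ x) x) (hg : ∀ x, HasDerivAt g (g₁ x) x) (x : ℝ) :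
    HasDerivAt (fun y => f (g y)) (f₁ (g x) * g₁ x) x :=
  (hf (g x)).comp x (hg x)

/-- SECOND-ORDER CHAIN RULE at a zero of the inner map: with `g 0 = 0`, `g′ = g₁` everywhere, `f₁′(0) = f₂` and
`g₁′(0) = g₂`, the derivative function `x ↦ f₁ (g x) · g₁ x` of `f ∘ g` has derivative `f₂ · g₁(0)² + f₁(0) · g₂` at `0`
— the one-variable form of `D²(f ∘ g) = D²f[Dg, Dg] + Df ∘ D²g`. [folklore] -/
theorem hasDerivAt_deriv_comp_zero (hg0 : g 0 = 0) (hg : ∀ x, HasDerivAt g (g₁ x) x) (hf₂ : HasDerivAt f₁ f₂ 0)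
    (hg₂ : HasDerivAt g₁ g₂ 0) :
    HasDerivAt (fun x => f₁ (g x) * g₁ x) (f₂ * g₁ 0 ^ 2 + f₁ 0 * g₂) 0 := by
  have hf₂' : HasDerivAt f₁ f₂ (g 0) := by rw [hg0]; exact hf₂
  have h1 : HasDerivAt (fun x => f₁ (g x)) (f₂ * g₁ 0) 0 := hf₂'.comp 0 (hg 0)
  have h2 := h1.mul hg₂
  have e : f₂ * g₁ 0 * g₁ 0 + f₁ (g 0) * g₂ = f₂ * g₁ 0 ^ 2 + f₁ 0 * g₂ := by rw [hg0]; ring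
  rw [← e]
  exact h2

end ChainRule

/-! ## §2 The tower: iterates of a map with a fixed point -/

/-- The data of a one-step map of the tower: a map `T : ℝ → ℝ` fixing `0`, its derivative function `T₁`, and a second
derivative `T₂` of `T` at the fixed point.  (Toy bookkeeping object; nothing of Bałaban's.) [folklore] -/
structure TowerMap where
  /-- the one-step map -/
  T : ℝ → ℝ
  /-- its derivative function -/
  T₁ : ℝ → ℝ
  /-- the second derivative of `T` at the fixed point `0` -/
  T₂ : ℝ
  fix : T 0 = 0
  d₁ : ∀ x, HasDerivAt T (T₁ x) x
  d₂ : HasDerivAt T₁ T₂ 0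

namespace TowerMap

variable (M : TowerMap)

/-- The one-step first-order rate `θ = T′(0)`. [folklore] -/
def θ : ℝ := M.T₁ 0

/-- The derivative FUNCTION of the `n`-fold iterate, by the chain-rule recursion `D (n+1) x = T₁ (T^[n] x) · D n x`.
[folklore] -/
def D : ℕ → ℝ → ℝ
  | 0 => fun _ => 1
  | n + 1 => fun x => M.T₁ (M.T^[n] x) * D n x

/-- The second derivative of the `n`-fold iterate AT THE FIXED POINT, by the second-order chain-rule recursion
`S (n+1) = T₂ · (D n 0)² + θ · S n` (first term: curvature injected at the new outermost step; second term: the earlier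
curvature transported at the first-order rate). [folklore] -/
def S : ℕ → ℝ
  | 0 => 0
  | n + 1 => M.T₂ * (M.D n 0) ^ 2 + M.θ * S n

/-- The `0`-fold iterate has derivative `1`. [folklore] -/
@[simp] theorem D_zero_apply (x : ℝ) : M.D 0 x = 1 := rfl

/-- The defining chain-rule recursion of `D`. [folklore] -/
theorem D_succ_apply (n : ℕ) (x : ℝ) : M.D (n + 1) x = M.T₁ (M.T^[n] x) * M.D n x := rfl

/-- The `0`-fold iterate (the identity) has second derivative `0`. [folklore] -/
@[simp] theorem S_zero : M.S 0 = 0 := rfl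

/-- The defining second-order chain-rule recursion of `S`. [folklore] -/
theorem S_succ (n : ℕ) : M.S (n + 1) = M.T₂ * (M.D n 0) ^ 2 + M.θ * M.S n := rfl

/-- The fixed point stays fixed under every iterate. [folklore] -/
theorem iterate_fix (n : ℕ) : M.T^[n] 0 = 0 :=
  Function.iterate_fixed M.fix n

/-- `D n` IS the derivative of the `n`-fold iterate (first-order chain rule along the tower). [folklore] -/
theorem hasDerivAt_iterate : ∀ (n : ℕ) (x : ℝ), HasDerivAt (M.T^[n]) (M.D n x) x
  | 0, x => by simpa using hasDerivAt_id x
  | n + 1, x => by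
      rw [Function.iterate_succ']
      exact (M.d₁ (M.T^[n] x)).comp x (hasDerivAt_iterate n x)

/-- At the fixed point the first derivative of the `n`-fold iterate is `θⁿ`. [folklore] -/
@[simp] theorem D_zero (n : ℕ) : M.D n 0 = M.θ ^ n := by
  induction n with
  | zero => simp
  | succ n ih => rw [D_succ_apply, iterate_fix, ih, pow_succ, θ]; ring

/-- `S n` IS the derivative at `0` of the derivative function `D n`: the second derivative of the `n`-fold iterate at
the fixed point (second-order chain rule along the tower). [folklore] -/
theorem hasDerivAt_D_zero : ∀ n : ℕ, HasDerivAt (M.D n) (M.S n) 0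
  | 0 => by
      show HasDerivAt (fun _ : ℝ => (1 : ℝ)) 0 0
      exact hasDerivAt_const (0 : ℝ) (1 : ℝ)
  | n + 1 => by
      show HasDerivAt (fun x => M.T₁ (M.T^[n] x) * M.D n x) (M.T₂ * (M.D n 0) ^ 2 + M.T₁ 0 * M.S n) 0
      exact hasDerivAt_deriv_comp_zero (M.iterate_fix n) (M.hasDerivAt_iterate n) M.d₂ (hasDerivAt_D_zero n)

/-- CLOSED FORM of the second derivative of the `(n+1)`-fold iterate at the fixed point:
`S (n+1) = T₂ · Σ_{j ≤ n} θ^{n+j}` (`= T₂ θⁿ (1 + θ + ⋯ + θⁿ)`). [folklore] -/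
theorem S_succ_eq (n : ℕ) : M.S (n + 1) = M.T₂ * ∑ j ∈ range (n + 1), M.θ ^ (n + j) := by
  induction n with
  | zero => simp [S_succ]
  | succ n ih =>
      rw [S_succ, ih, D_zero, sum_range_succ (fun j => M.θ ^ (n + 1 + j)), mul_add]
      have e1 : (M.θ ^ (n + 1)) ^ 2 = M.θ ^ (n + 1 + (n + 1)) := by rw [sq, ← pow_add]
      have e2 : ∀ j ∈ range (n + 1), M.θ * M.θ ^ (n + j) = M.θ ^ (n + 1 + j) := by
        intro j _
        rw [← pow_succ']
        congr 1
        omega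
      have e3 : M.θ * (M.T₂ * ∑ j ∈ range (n + 1), M.θ ^ (n + j))
          = M.T₂ * ∑ j ∈ range (n + 1), M.θ ^ (n + 1 + j) := by
        rw [← sum_congr rfl e2, ← mul_sum]
        ring
      rw [e1, e3]
      ring

/-- The same closed form for all `n`, with a truncated subtraction (`S 0 = 0` is the empty sum):
`S n = T₂ · Σ_{j < n} θ^{n−1+j}`. [folklore] -/
theorem S_eq (n : ℕ) : M.S n = M.T₂ * ∑ j ∈ range n, M.θ ^ (n - 1 + j) := by
  cases n with
  | zero => simp
  | succ n => simpa using M.S_succ_eq n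

/-- THE LINEAR CASE: if the one-step map has no curvature at the fixed point (`T₂ = 0`) then every iterate has zero
second derivative there — the abelian ∕ linear-averaging value behind the expectation `θ₂ ≍ θ₁²`. [folklore] -/
theorem S_eq_zero_of_T₂ (h : M.T₂ = 0) (n : ℕ) : M.S n = 0 := by
  rw [S_eq, h, zero_mul]

/-- LOWER BOUND (transported first-step curvature): for `0 ≤ θ` and `0 ≤ T₂`, `T₂ · θⁿ ≤ S (n+1)` — the second
derivative of the iterate decays no faster than the FIRST-order rate. [folklore] -/
theorem S_succ_lower (hθ : 0 ≤ M.θ) (hT : 0 ≤ M.T₂) (n : ℕ) : M.T₂ * M.θ ^ n ≤ M.S (n + 1) := by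
  rw [S_succ_eq]
  refine mul_le_mul_of_nonneg_left ?_ hT
  have h0 : (0 : ℕ) ∈ range (n + 1) := mem_range.mpr (Nat.succ_pos n)
  have h := single_le_sum (s := range (n + 1)) (f := fun j => M.θ ^ (n + j)) (fun j _ => pow_nonneg hθ (n + j)) h0
  simpa using h

/-- UPPER BOUND: for `0 ≤ θ < 1` and `0 ≤ T₂`, `S (n+1) ≤ T₂ · θⁿ / (1 − θ)` (geometric sum). [folklore] -/
theorem S_succ_upper (hθ0 : 0 ≤ M.θ) (hθ1 : M.θ < 1) (hT : 0 ≤ M.T₂) (n : ℕ) :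
    M.S (n + 1) ≤ M.T₂ * M.θ ^ n / (1 - M.θ) := by
  have hpos : 0 < 1 - M.θ := sub_pos.mpr hθ1
  rw [S_succ_eq, le_div_iff₀ hpos]
  have hsplit : ∑ j ∈ range (n + 1), M.θ ^ (n + j) = M.θ ^ n * ∑ j ∈ range (n + 1), M.θ ^ j := by
    rw [mul_sum]
    refine sum_congr rfl fun j _ => ?_
    rw [pow_add]
  have hgeom : (∑ j ∈ range (n + 1), M.θ ^ j) * (1 - M.θ) = 1 - M.θ ^ (n + 1) := geom_sum_mul_neg M.θ (n + 1)
  have hle : (∑ j ∈ range (n + 1), M.θ ^ j) * (1 - M.θ) ≤ 1 := by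
    rw [hgeom]
    have : 0 ≤ M.θ ^ (n + 1) := pow_nonneg hθ0 _
    linarith
  calc M.T₂ * (∑ j ∈ range (n + 1), M.θ ^ (n + j)) * (1 - M.θ)
      = M.T₂ * M.θ ^ n * ((∑ j ∈ range (n + 1), M.θ ^ j) * (1 - M.θ)) := by rw [hsplit]; ring
    _ ≤ M.T₂ * M.θ ^ n * 1 :=
        mul_le_mul_of_nonneg_left hle (mul_nonneg hT (pow_nonneg hθ0 n))
    _ = M.T₂ * M.θ ^ n := mul_one _

/-! ## §3 The rate statement: second order decays at the first-order rate -/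

/-- THE RATE STATEMENT: for `0 < θ < 1` and `0 < T₂` the second derivative of the iterates at the fixed point is NOT
`O(θ^{2n})` — for every constant `C` some `n` has `C · (θⁿ)² < S n`. [folklore] -/
theorem exists_sq_rate_lt_S (hθ0 : 0 < M.θ) (hθ1 : M.θ < 1) (hT : 0 < M.T₂) (C : ℝ) :
    ∃ n : ℕ, C * (M.θ ^ n) ^ 2 < M.S n := by
  by_cases hC : 0 < C
  · obtain ⟨n, hn⟩ := exists_pow_lt_of_lt_one (div_pos hT hC) hθ1
    refine ⟨n + 1, ?_⟩
    have hlow : M.T₂ * M.θ ^ n ≤ M.S (n + 1) := M.S_succ_lower hθ0.le hT.le n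
    have hθn : 0 < M.θ ^ n := pow_pos hθ0 n
    have hpow : M.θ ^ (n + 2) ≤ M.θ ^ n := pow_le_pow_of_le_one hθ0.le hθ1.le (by omega)
    have hCn : C * M.θ ^ n < M.T₂ := by
      have h' := (lt_div_iff₀ hC).mp hn
      rwa [mul_comm] at h'
    have hkey : C * M.θ ^ (n + 2) < M.T₂ := lt_of_le_of_lt (mul_le_mul_of_nonneg_left hpow hC.le) hCn
    have e : C * (M.θ ^ (n + 1)) ^ 2 = C * M.θ ^ (n + 2) * M.θ ^ n := by ring
    rw [e]
    exact lt_of_lt_of_le (mul_lt_mul_of_pos_right hkey hθn) hlow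
  · have hC' : C ≤ 0 := not_lt.mp hC
    refine ⟨1, ?_⟩
    have h1 : M.T₂ * M.θ ^ 0 ≤ M.S 1 := M.S_succ_lower hθ0.le hT.le 0
    have h2 : C * (M.θ ^ 1) ^ 2 ≤ 0 := mul_nonpos_of_nonpos_of_nonneg hC' (sq_nonneg _)
    have h3 : 0 < M.T₂ * M.θ ^ 0 := by simpa using hT
    linarith

/-- THE PULLED-BACK OBSERVABLE `W ∘ T^[n]`: its derivative function is `x ↦ W₁ (T^[n] x) · D n x`, and at the fixed
point the derivative of that function (the observable's second derivative) is `W₂ · (θⁿ)² + W₁ 0 · S n` — the "linear"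
term at the rate `θ^{2n}` PLUS the transported-curvature term `W₁(0) · S n` at the rate `θⁿ`. [folklore] -/
theorem hasDerivAt_obs_iterate {W W₁ : ℝ → ℝ} {W₂ : ℝ} (hW : ∀ x, HasDerivAt W (W₁ x) x) (hW₂ : HasDerivAt W₁ W₂ 0)
    (n : ℕ) :
    (∀ x, HasDerivAt (fun y => W (M.T^[n] y)) (W₁ (M.T^[n] x) * M.D n x) x) ∧
      HasDerivAt (fun x => W₁ (M.T^[n] x) * M.D n x) (W₂ * (M.θ ^ n) ^ 2 + W₁ 0 * M.S n) 0 := by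
  refine ⟨fun x => hasDerivAt_comp_pt hW (M.hasDerivAt_iterate n) x, ?_⟩
  have h := hasDerivAt_deriv_comp_zero (M.iterate_fix n) (M.hasDerivAt_iterate n) hW₂ (M.hasDerivAt_D_zero n)
  simpa only [D_zero] using h

/-- In the LINEAR case `T₂ = 0` the observable's second derivative at the fixed point IS `W₂ · θ^{2n}` — the rate `θ₁²`
of the abelian model. [folklore] -/
theorem obs_second_eq_of_T₂ (h : M.T₂ = 0) (W₂ w₁ : ℝ) (n : ℕ) :
    W₂ * (M.θ ^ n) ^ 2 + w₁ * M.S n = W₂ * M.θ ^ (2 * n) := by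
  rw [M.S_eq_zero_of_T₂ h, mul_zero, add_zero, ← pow_mul, mul_comm n 2]

/-- With curvature (`0 < T₂`, `0 < θ < 1`) and an observable with `W₁ 0 > 0`, the observable's second derivative at
the fixed point, `W₂ · (θⁿ)² + W₁ 0 · S n`, is NOT `O(θ^{2n})`: for every `C` some `n` has
`C · (θⁿ)² < W₂ · (θⁿ)² + W₁ 0 · S n`. [folklore] -/
theorem exists_sq_rate_lt_obs (hθ0 : 0 < M.θ) (hθ1 : M.θ < 1) (hT : 0 < M.T₂) {w₁ : ℝ} (hw : 0 < w₁) (W₂ C : ℝ) :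
    ∃ n : ℕ, C * (M.θ ^ n) ^ 2 < W₂ * (M.θ ^ n) ^ 2 + w₁ * M.S n := by
  obtain ⟨n, hn⟩ := M.exists_sq_rate_lt_S hθ0 hθ1 hT ((C - W₂) / w₁)
  refine ⟨n, ?_⟩
  have h1 : (C - W₂) * (M.θ ^ n) ^ 2 / w₁ < M.S n := by rwa [div_mul_eq_mul_div] at hn
  have h2 : (C - W₂) * (M.θ ^ n) ^ 2 < M.S n * w₁ := (div_lt_iff₀ hw).mp h1
  have h3 : C * (M.θ ^ n) ^ 2 - W₂ * (M.θ ^ n) ^ 2 < w₁ * M.S n := by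
    rwa [sub_mul, mul_comm (M.S n)] at h2
  linarith

end TowerMap

/-! ## §4 Non-vacuity: the quadratic one-step map -/

/-- The quadratic map `x ↦ θ x + τ x²` as a `TowerMap`: `T₁ x = θ + 2τ x`, `T₂ = 2τ`. [folklore] -/
noncomputable def quadratic (θ τ : ℝ) : TowerMap where
  T := fun x => θ * x + τ * (x * x)
  T₁ := fun x => θ + 2 * τ * x
  T₂ := 2 * τ
  fix := by simp
  d₁ := by
    intro x
    have h1 : HasDerivAt (fun y : ℝ => θ * y) (θ * 1) x := (hasDerivAt_id' x).const_mul θ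
    have h2 : HasDerivAt (fun y : ℝ => y * y) (1 * x + x * 1) x := (hasDerivAt_id' x).mul (hasDerivAt_id' x)
    have h3 : HasDerivAt (fun y : ℝ => τ * (y * y)) (τ * (1 * x + x * 1)) x := h2.const_mul τ
    have h4 := h1.add h3
    have e : θ * 1 + τ * (1 * x + x * 1) = θ + 2 * τ * x := by ring
    rw [e] at h4
    exact h4
  d₂ := by
    have h1 : HasDerivAt (fun y : ℝ => 2 * τ * y) (2 * τ * 1) 0 := (hasDerivAt_id' (0 : ℝ)).const_mul (2 * τ)
    have h2 := h1.const_add θ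
    simpa using h2

/-- The quadratic map's one-step rate is `θ`. [folklore] -/
@[simp] theorem quadratic_θ (θ τ : ℝ) : (quadratic θ τ).θ = θ := by
  simp [TowerMap.θ, quadratic]

/-- The quadratic map's one-step curvature is `2τ`. [folklore] -/
@[simp] theorem quadratic_T₂ (θ τ : ℝ) : (quadratic θ τ).T₂ = 2 * τ := rfl

/-- For the quadratic map the second derivative of the `(n+1)`-fold iterate at `0` is `2τ Σ_{j ≤ n} θ^{n+j}`
(`= 2τ θⁿ (1 + θ + ⋯ + θⁿ) ≥ 2τ θⁿ`): exactly the first-order rate. [folklore] -/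
theorem quadratic_S_succ (θ τ : ℝ) (n : ℕ) :
    (quadratic θ τ).S (n + 1) = 2 * τ * ∑ j ∈ range (n + 1), θ ^ (n + j) := by
  rw [TowerMap.S_succ_eq, quadratic_T₂, quadratic_θ]

/-- … and it is not `O(θ^{2n})` for `0 < θ < 1`, `0 < τ`. [folklore] -/
theorem quadratic_not_sq_rate {θ τ : ℝ} (hθ0 : 0 < θ) (hθ1 : θ < 1) (hτ : 0 < τ) (C : ℝ) :
    ∃ n : ℕ, C * (θ ^ n) ^ 2 < (quadratic θ τ).S n := by
  have h := (quadratic θ τ).exists_sq_rate_lt_S (by simpa using hθ0) (by simpa using hθ1)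
    (by rw [quadratic_T₂]; linarith) C
  simpa using h

end Literature.MathematicalPhysics.QuantumFieldTheory.Balaban1983to89.T4JetTower
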